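import Summits.CriticalPhenomena.PercolationContinuityZ3.Theorems.PercNearOneGluingNoHeavyLowerTailKnQuestion8CoefficientwiseRootSectorTwo
import HarnessLib

/-!
# NC* at a root of degree two is a two-terminal statement on `H = G − x` — prim-lf-2 gen 66

Support file (`--supports stmt-CriticalPhenomena-4575`, closed), prover `prim-lf-2` (gen 66).  No definitions, no named facts, no sorries; standard axioms.
Memo `prim-lf-2/CW-BASE-gen66.md` §1; cluster bookkeeping from gen 37/38's `…CoefficientwiseRootSectorTwo.lean` (`mem_openCluster_insert_two_rootEdges_iff` etc.).

Setting (CONJECTURE NC*, prim-lf-2 gen 63/65; `…CoefficientwiseContractionW.lean`): finite multigraph `ends : ι → Sym2 V`, edge set `E`, root `x`, target set `W ∌ x`,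
`C_v(s) = openCluster (ends '' s) v`,
  `NC*_E(x,W)[f,g] := Σ_{s ⊆ E : ∀ w ∈ W, ¬(w ∈ C_x(s) ∧ w ∈ C_x(E∖s))} (f(C_x s) − f(C_x(E∖s)))·(g(C_x s) − g(C_x(E∖s)))`.
Suppose the only edges of `E` at `x` are `e₁ ≠ e₂` with ends `{x,p}`, `{x,q}` (a ROOT OF DEGREE TWO) and put `E' = (E ∖ e₁) ∖ e₂` (the edges of `H = G − x`).  Resolving the colours of
`e₁, e₂`: in the two PURE sectors the clusters are `{x} ∪ C_p(t) ∪ C_q(t)` against `{x}` (the NC* event holds automatically), in the two MIXED sectors they are `{x} ∪ C_p(t)` against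
`{x} ∪ C_q(E'∖t)` (red cluster of `p` against blue cluster of `q` IN `H`), and the two sectors of each kind agree under `t ↦ E' ∖ t`.  Hence, for ALL `f, g : Set V → ℝ`:
* `Coefficientwise.ncStar_rootDegTwo_eq` — **THE DEGREE-TWO IDENTITY**
  `NC*_E(x,W)[f,g] = 2·Σ_{t ⊆ E'} (f({x}∪C_p t∪C_q t) − f{x})(g({x}∪C_p t∪C_q t) − g{x}) + 2·Σ_{t ⊆ E' : ∀ w∈W, ¬(w ∈ C_p t ∧ w ∈ C_q(E'∖t))} (f({x}∪C_p t) − f({x}∪C_q(E'∖t)))(g(…) − g(…))`;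
* `Coefficientwise.ncStar_nonneg_of_rootDegTwo` — COROLLARY: `0 ≤ PURE + MIXED` on `H` (the two sums above) implies `0 ≤ NC*_E(x,W)[f,g]`.
So CONJECTURE NC* at degree-two roots — in particular the BASE case of the root-contraction skeleton `ncStar_of_rootContractionW` (gen 65) at such roots, `W ⊇ {p,q}`, where the
mixed event reads 'no monochromatic `p–q` path in `H` and no vertex of `W` red-joined to `p` and blue-joined to `q`' — is EXACTLY the two-terminal inequality `PURE + MIXED ≥ 0` on
`(H; p, q)`.  Census/negative results for it (prim-lf-2 gen 65/66): the mixed sum alone is negative (gen 65 ts.c); a dominating injection of the mixed event into the pure colourings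
exists for all 2-connected `G` on ≤ 9 vertices but NOT at `n = 10` (gen 66, memo §1), so the inequality is not a pure domination statement.
[cite: KozmaNitzan2024, Questions 8–9 (§5.5 p. 36) (context: the Question-8 pocket covariance programme)]
-/

namespace Summit.CriticalPhenomena.PercolationContinuityZ3.Theorems

open Finset Literature.Probability.Percolation

namespace Coefficientwise

variable {ι V : Type*} (ends : ι → Sym2 V)

section sums

variable [DecidableEq ι]

open Classical in
/-- **NC* AT A ROOT OF DEGREE TWO — THE TWO-TERMINAL IDENTITY** (prim-lf-2 gen 66).  Let the only edges of `E` at `x` be `e₁ ≠ e₂` with ends `{x,p}`, `{x,q}`,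
`E' = (E.erase e₁).erase e₂`, `x ∉ W`.  Then for all `f, g : Set V → ℝ`,
`NC*_E(x,W)[f,g] = 2·Σ_{t ⊆ E'} (f({x} ∪ C_p t ∪ C_q t) − f {x})(g(…) − g {x}) + 2·Σ_{t ⊆ E' : ∀ w ∈ W, ¬(w ∈ C_p t ∧ w ∈ C_q(E'∖t))} (f({x} ∪ C_p t) − f({x} ∪ C_q(E'∖t)))(g(…) − g(…))`.
[cite: KozmaNitzan2024, Questions 8–9 (§5.5 p. 36) (context)] -/
theorem ncStar_rootDegTwo_eq (E : Finset ι) {x p q : V} {e₁ e₂ : ι} (he₁ : e₁ ∈ E) (he₂ : e₂ ∈ E) (hne : e₁ ≠ e₂)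
    (h₁ : ends e₁ = s(x, p)) (h₂ : ends e₂ = s(x, q)) (hroot : ∀ i ∈ E, x ∈ ends i → i = e₁ ∨ i = e₂)
    (W : Set V) (hxW : x ∉ W) (f g : Set V → ℝ) :
    ∑ s ∈ E.powerset.filter (fun s : Finset ι =>
          ∀ w ∈ W, ¬ (w ∈ openCluster (ends '' (↑s : Set ι)) x ∧ w ∈ openCluster (ends '' (↑(E \ s) : Set ι)) x)),
      (f (openCluster (ends '' (↑s : Set ι)) x) - f (openCluster (ends '' (↑(E \ s) : Set ι)) x)) *
        (g (openCluster (ends '' (↑s : Set ι)) x) - g (openCluster (ends '' (↑(E \ s) : Set ι)) x)) =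
    2 * (∑ t ∈ ((E.erase e₁).erase e₂).powerset,
      (f (insert x (openCluster (ends '' (↑t : Set ι)) p ∪ openCluster (ends '' (↑t : Set ι)) q)) - f {x}) *
        (g (insert x (openCluster (ends '' (↑t : Set ι)) p ∪ openCluster (ends '' (↑t : Set ι)) q)) - g {x})) +
    2 * (∑ t ∈ ((E.erase e₁).erase e₂).powerset.filter (fun t : Finset ι => ∀ w ∈ W,
          ¬ (w ∈ openCluster (ends '' (↑t : Set ι)) p ∧ w ∈ openCluster (ends '' (↑(((E.erase e₁).erase e₂) \ t) : Set ι)) q)),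
      (f (insert x (openCluster (ends '' (↑t : Set ι)) p)) - f (insert x (openCluster (ends '' (↑(((E.erase e₁).erase e₂) \ t) : Set ι)) q))) *
        (g (insert x (openCluster (ends '' (↑t : Set ι)) p)) - g (insert x (openCluster (ends '' (↑(((E.erase e₁).erase e₂) \ t) : Set ι)) q)))) := by
  set E' : Finset ι := (E.erase e₁).erase e₂ with hE'
  have he₁E' : e₁ ∉ E' := fun h => Finset.notMem_erase e₁ E (Finset.mem_of_mem_erase h)
  have he₂E' : e₂ ∉ E' := Finset.notMem_erase e₂ _
  have he₁E'' : e₁ ∉ insert e₂ E' := by rw [Finset.mem_insert]; rintro (h | h); exacts [hne h, he₁E' h]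
  have hE : E = insert e₁ (insert e₂ E') := by
    rw [hE', Finset.insert_erase (Finset.mem_erase.mpr ⟨fun h => hne h.symm, he₂⟩), Finset.insert_erase he₁]
  -- edges of `E'` avoid `x`
  have hE'x : ∀ i ∈ E', x ∉ ends i := by
    intro i hi hxi
    have hiE : i ∈ E := Finset.mem_of_mem_erase (Finset.mem_of_mem_erase hi)
    rcases hroot i hiE hxi with hi1 | hi2
    · exact he₁E' (hi1 ▸ hi)
    · exact he₂E' (hi2 ▸ hi)
  have htx : ∀ t : Finset ι, t ⊆ E' → ∀ i ∈ t, x ∉ ends i := fun t ht i hi => hE'x i (ht hi)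
  have hsd : ∀ t : Finset ι, E' \ t ⊆ E' := fun t => Finset.sdiff_subset
  have hWx : ∀ w ∈ W, w ≠ x := fun w hw hwx => hxW (hwx ▸ hw)
  -- complements inside `E = insert e₁ (insert e₂ E')`
  have cRR : ∀ t, t ⊆ E' → (insert e₁ (insert e₂ E')) \ (insert e₁ (insert e₂ t)) = E' \ t := by
    intro t ht; ext i
    simp only [Finset.mem_sdiff, Finset.mem_insert, not_or]
    constructor
    · rintro ⟨h1, h2, h3, h4⟩
      rcases h1 with h1 | h1 | h1
      · exact absurd h1 h2
      · exact absurd h1 h3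
      · exact ⟨h1, h4⟩
    · rintro ⟨h1, h2⟩
      exact ⟨Or.inr (Or.inr h1), fun h => he₁E' (h ▸ h1), fun h => he₂E' (h ▸ h1), h2⟩
  have cBB : ∀ t, t ⊆ E' → (insert e₁ (insert e₂ E')) \ t = insert e₁ (insert e₂ (E' \ t)) := by
    intro t ht; ext i
    simp only [Finset.mem_sdiff, Finset.mem_insert]
    constructor
    · rintro ⟨h1, h2⟩
      rcases h1 with h1 | h1 | h1
      · exact Or.inl h1
      · exact Or.inr (Or.inl h1)
      · exact Or.inr (Or.inr ⟨h1, h2⟩)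
    · rintro (h1 | h1 | ⟨h1, h2⟩)
      · exact ⟨Or.inl h1, fun h => he₁E' (ht (h1 ▸ h))⟩
      · exact ⟨Or.inr (Or.inl h1), fun h => he₂E' (ht (h1 ▸ h))⟩
      · exact ⟨Or.inr (Or.inr h1), h2⟩
  have cRB : ∀ t, t ⊆ E' → (insert e₁ (insert e₂ E')) \ (insert e₁ t) = insert e₂ (E' \ t) := by
    intro t ht; ext i
    simp only [Finset.mem_sdiff, Finset.mem_insert, not_or]
    constructor
    · rintro ⟨h1, h2, h3⟩
      rcases h1 with h1 | h1 | h1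
      · exact absurd h1 h2
      · exact Or.inl h1
      · exact Or.inr ⟨h1, h3⟩
    · rintro (h1 | ⟨h1, h2⟩)
      · exact ⟨Or.inr (Or.inl h1), fun h => hne (h.symm.trans h1), fun h => he₂E' (ht (h1 ▸ h))⟩
      · exact ⟨Or.inr (Or.inr h1), fun h => he₁E' (h ▸ h1), h2⟩
  have cBR : ∀ t, t ⊆ E' → (insert e₁ (insert e₂ E')) \ (insert e₂ t) = insert e₁ (E' \ t) := by
    intro t ht; ext i
    simp only [Finset.mem_sdiff, Finset.mem_insert, not_or]
    constructor
    · rintro ⟨h1, h2, h3⟩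
      rcases h1 with h1 | h1 | h1
      · exact Or.inl h1
      · exact absurd h1 h2
      · exact Or.inr ⟨h1, h3⟩
    · rintro (h1 | ⟨h1, h2⟩)
      · exact ⟨Or.inl h1, fun h => hne (h1.symm.trans h), fun h => he₁E' (ht (h1 ▸ h))⟩
      · exact ⟨Or.inr (Or.inr h1), fun h => he₂E' (h ▸ h1), h2⟩
  -- the clusters of `x` in the four sectors, as sets
  have kRR : ∀ t, t ⊆ E' → openCluster (ends '' (↑(insert e₁ (insert e₂ t)) : Set ι)) x =
      insert x (openCluster (ends '' (↑t : Set ι)) p ∪ openCluster (ends '' (↑t : Set ι)) q) := by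
    intro t ht; ext v
    rw [mem_openCluster_insert_two_rootEdges_iff ends h₁ h₂ (htx t ht), Set.mem_insert_iff, Set.mem_union]
  have k0 : ∀ t, t ⊆ E' → openCluster (ends '' (↑t : Set ι)) x = {x} := by
    intro t ht; ext v
    rw [mem_openCluster_iff_eq_of_rootless ends (htx t ht), Set.mem_singleton_iff]
  have kR : ∀ t, t ⊆ E' → openCluster (ends '' (↑(insert e₁ t) : Set ι)) x = insert x (openCluster (ends '' (↑t : Set ι)) p) := by
    intro t ht; ext v
    rw [mem_openCluster_insert_rootEdge_iff ends h₁ (htx t ht), Set.mem_insert_iff]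
  have kB : ∀ t, t ⊆ E' → openCluster (ends '' (↑(insert e₂ t) : Set ι)) x = insert x (openCluster (ends '' (↑t : Set ι)) q) := by
    intro t ht; ext v
    rw [mem_openCluster_insert_rootEdge_iff ends h₂ (htx t ht), Set.mem_insert_iff]
  -- event bookkeeping: a target `w ≠ x` lies in `insert x A` iff it lies in `A`
  have evI : ∀ (A B : Set V), (∀ w ∈ W, ¬ (w ∈ insert x A ∧ w ∈ insert x B)) ↔ (∀ w ∈ W, ¬ (w ∈ A ∧ w ∈ B)) := by
    intro A B
    refine forall₂_congr fun w hw => not_congr ?_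
    rw [Set.mem_insert_iff, Set.mem_insert_iff]
    exact ⟨fun h => ⟨h.1.resolve_left (hWx w hw), h.2.resolve_left (hWx w hw)⟩, fun h => ⟨Or.inr h.1, Or.inr h.2⟩⟩
  have evT : ∀ (A : Set V), (∀ w ∈ W, ¬ (w ∈ A ∧ w ∈ ({x} : Set V))) := fun A w hw h => hWx w hw (Set.mem_singleton_iff.mp h.2)
  have evT' : ∀ (A : Set V), (∀ w ∈ W, ¬ (w ∈ ({x} : Set V) ∧ w ∈ A)) := fun A w hw h => hWx w hw (Set.mem_singleton_iff.mp h.1)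
  -- the two target summands
  set fRR : Finset ι → ℝ := fun t =>
    (f (insert x (openCluster (ends '' (↑t : Set ι)) p ∪ openCluster (ends '' (↑t : Set ι)) q)) - f {x}) *
      (g (insert x (openCluster (ends '' (↑t : Set ι)) p ∪ openCluster (ends '' (↑t : Set ι)) q)) - g {x}) with hfRR
  set fRB : Finset ι → ℝ := fun t => (if (∀ w ∈ W, ¬ (w ∈ openCluster (ends '' (↑t : Set ι)) p ∧ w ∈ openCluster (ends '' (↑(E' \ t) : Set ι)) q)) then
    (f (insert x (openCluster (ends '' (↑t : Set ι)) p)) - f (insert x (openCluster (ends '' (↑(E' \ t) : Set ι)) q))) *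
      (g (insert x (openCluster (ends '' (↑t : Set ι)) p)) - g (insert x (openCluster (ends '' (↑(E' \ t) : Set ι)) q))) else 0) with hfRB
  -- rewrite the left-hand side as a sum over `t ⊆ E'` of the four sector summands
  rw [Finset.sum_filter, hE, Finset.sum_powerset_insert he₁E'', Finset.sum_powerset_insert he₂E',
    Finset.sum_powerset_insert he₂E']
  -- sector BB (`s = t`)
  have sBB : ∀ t ∈ E'.powerset, (if (∀ w ∈ W, ¬ (w ∈ openCluster (ends '' (↑t : Set ι)) x ∧ w ∈ openCluster (ends '' (↑(insert e₁ (insert e₂ E') \ t) : Set ι)) x)) then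
      (f (openCluster (ends '' (↑t : Set ι)) x) - f (openCluster (ends '' (↑(insert e₁ (insert e₂ E') \ t) : Set ι)) x)) *
        (g (openCluster (ends '' (↑t : Set ι)) x) - g (openCluster (ends '' (↑(insert e₁ (insert e₂ E') \ t) : Set ι)) x)) else 0) = fRR (E' \ t) := by
    intro t ht
    have htE : t ⊆ E' := Finset.mem_powerset.mp ht
    rw [cBB t htE, kRR (E' \ t) (hsd t), k0 t htE, hfRR]
    dsimp only
    rw [if_pos (evT' _)]
    ring
  -- sector BR (`s = insert e₂ t`)
  have sBR : ∀ t ∈ E'.powerset, (if (∀ w ∈ W, ¬ (w ∈ openCluster (ends '' (↑(insert e₂ t) : Set ι)) x ∧ w ∈ openCluster (ends '' (↑(insert e₁ (insert e₂ E') \ insert e₂ t) : Set ι)) x)) then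
      (f (openCluster (ends '' (↑(insert e₂ t) : Set ι)) x) - f (openCluster (ends '' (↑(insert e₁ (insert e₂ E') \ insert e₂ t) : Set ι)) x)) *
        (g (openCluster (ends '' (↑(insert e₂ t) : Set ι)) x) - g (openCluster (ends '' (↑(insert e₁ (insert e₂ E') \ insert e₂ t) : Set ι)) x)) else 0) = fRB (E' \ t) := by
    intro t ht
    have htE : t ⊆ E' := Finset.mem_powerset.mp ht
    have hss : E' \ (E' \ t) = t := Finset.sdiff_sdiff_eq_self htE
    rw [cBR t htE, kB t htE, kR (E' \ t) (hsd t), hfRB]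
    dsimp only
    rw [hss, evI]
    have hcomm : (∀ w ∈ W, ¬ (w ∈ openCluster (ends '' (↑t : Set ι)) q ∧ w ∈ openCluster (ends '' (↑(E' \ t) : Set ι)) p)) ↔
        (∀ w ∈ W, ¬ (w ∈ openCluster (ends '' (↑(E' \ t) : Set ι)) p ∧ w ∈ openCluster (ends '' (↑t : Set ι)) q)) :=
      forall₂_congr fun w _ => not_congr and_comm
    by_cases hW : ∀ w ∈ W, ¬ (w ∈ openCluster (ends '' (↑(E' \ t) : Set ι)) p ∧ w ∈ openCluster (ends '' (↑t : Set ι)) q)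
    · rw [if_pos (hcomm.mpr hW), if_pos hW]
      ring
    · rw [if_neg (fun h => hW (hcomm.mp h)), if_neg hW]
  -- sector RB (`s = insert e₁ t`)
  have sRB : ∀ t ∈ E'.powerset, (if (∀ w ∈ W, ¬ (w ∈ openCluster (ends '' (↑(insert e₁ t) : Set ι)) x ∧ w ∈ openCluster (ends '' (↑(insert e₁ (insert e₂ E') \ insert e₁ t) : Set ι)) x)) then
      (f (openCluster (ends '' (↑(insert e₁ t) : Set ι)) x) - f (openCluster (ends '' (↑(insert e₁ (insert e₂ E') \ insert e₁ t) : Set ι)) x)) *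
        (g (openCluster (ends '' (↑(insert e₁ t) : Set ι)) x) - g (openCluster (ends '' (↑(insert e₁ (insert e₂ E') \ insert e₁ t) : Set ι)) x)) else 0) = fRB t := by
    intro t ht
    have htE : t ⊆ E' := Finset.mem_powerset.mp ht
    rw [cRB t htE, kR t htE, kB (E' \ t) (hsd t), hfRB]
    dsimp only
    rw [evI]
  -- sector RR (`s = insert e₁ (insert e₂ t)`)
  have sRR : ∀ t ∈ E'.powerset, (if (∀ w ∈ W, ¬ (w ∈ openCluster (ends '' (↑(insert e₁ (insert e₂ t)) : Set ι)) x ∧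
        w ∈ openCluster (ends '' (↑(insert e₁ (insert e₂ E') \ insert e₁ (insert e₂ t)) : Set ι)) x)) then
      (f (openCluster (ends '' (↑(insert e₁ (insert e₂ t)) : Set ι)) x) - f (openCluster (ends '' (↑(insert e₁ (insert e₂ E') \ insert e₁ (insert e₂ t)) : Set ι)) x)) *
        (g (openCluster (ends '' (↑(insert e₁ (insert e₂ t)) : Set ι)) x) - g (openCluster (ends '' (↑(insert e₁ (insert e₂ E') \ insert e₁ (insert e₂ t)) : Set ι)) x)) else 0) = fRR t := by
    intro t ht
    have htE : t ⊆ E' := Finset.mem_powerset.mp ht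
    rw [cRR t htE, kRR t htE, k0 (E' \ t) (hsd t), hfRR]
    dsimp only
    rw [if_pos (evT _)]
  rw [Finset.sum_congr rfl sBB, Finset.sum_congr rfl sBR, Finset.sum_congr rfl sRB, Finset.sum_congr rfl sRR]
  -- `t ↦ E' \ t` is an involution of `E'.powerset`
  have reflect : ∀ φ : Finset ι → ℝ, ∑ t ∈ E'.powerset, φ (E' \ t) = ∑ t ∈ E'.powerset, φ t := by
    intro φ
    refine Finset.sum_nbij' (fun t => E' \ t) (fun t => E' \ t) ?_ ?_ ?_ ?_ ?_
    · exact fun t _ => Finset.mem_powerset.mpr Finset.sdiff_subset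
    · exact fun t _ => Finset.mem_powerset.mpr Finset.sdiff_subset
    exacts [fun t ht => Finset.sdiff_sdiff_eq_self (Finset.mem_powerset.mp ht),
      fun t ht => Finset.sdiff_sdiff_eq_self (Finset.mem_powerset.mp ht), fun t _ => rfl]
  rw [reflect fRR, reflect fRB, Finset.sum_filter]
  have eRB : ∑ t ∈ E'.powerset, fRB t = ∑ t ∈ E'.powerset, (if (∀ w ∈ W, ¬ (w ∈ openCluster (ends '' (↑t : Set ι)) p ∧ w ∈ openCluster (ends '' (↑(E' \ t) : Set ι)) q)) then
    (f (insert x (openCluster (ends '' (↑t : Set ι)) p)) - f (insert x (openCluster (ends '' (↑(E' \ t) : Set ι)) q))) *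
      (g (insert x (openCluster (ends '' (↑t : Set ι)) p)) - g (insert x (openCluster (ends '' (↑(E' \ t) : Set ι)) q))) else 0) := rfl
  have eRR : ∑ t ∈ E'.powerset, fRR t = ∑ t ∈ E'.powerset,
    (f (insert x (openCluster (ends '' (↑t : Set ι)) p ∪ openCluster (ends '' (↑t : Set ι)) q)) - f {x}) *
      (g (insert x (openCluster (ends '' (↑t : Set ι)) p ∪ openCluster (ends '' (↑t : Set ι)) q)) - g {x}) := rfl
  rw [eRR, eRB]
  ring

open Classical in
/-- **COROLLARY: NC* at a root of degree two follows from the two-terminal inequality `PURE + MIXED ≥ 0` on `H = G − x`.**  With the notation of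
`ncStar_rootDegTwo_eq` (root edges `e₁ = {x,p} ≠ e₂ = {x,q}` the only edges at `x`, `E'` the other edges, `x ∉ W`): if
`0 ≤ Σ_{t ⊆ E'} (f({x}∪C_p t∪C_q t) − f{x})(g(…) − g{x}) + Σ_{t ⊆ E' : ∀ w∈W, ¬(w ∈ C_p t ∧ w ∈ C_q(E'∖t))} (f({x}∪C_p t) − f({x}∪C_q(E'∖t)))(g(…) − g(…))`
then `0 ≤ NC*_E(x,W)[f,g]`.  (For monotone `f, g` the pure summands are `≥ 0` termwise; the mixed sum is the whole difficulty — for `W ⊇ {p,q}` this is the BASE case of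
`ncStar_of_rootContractionW` at a degree-two root.)  [cite: KozmaNitzan2024, Questions 8–9 (§5.5 p. 36) (context)] -/
theorem ncStar_nonneg_of_rootDegTwo (E : Finset ι) {x p q : V} {e₁ e₂ : ι} (he₁ : e₁ ∈ E) (he₂ : e₂ ∈ E) (hne : e₁ ≠ e₂)
    (h₁ : ends e₁ = s(x, p)) (h₂ : ends e₂ = s(x, q)) (hroot : ∀ i ∈ E, x ∈ ends i → i = e₁ ∨ i = e₂)
    (W : Set V) (hxW : x ∉ W) (f g : Set V → ℝ)
    (hH : 0 ≤ (∑ t ∈ ((E.erase e₁).erase e₂).powerset,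
      (f (insert x (openCluster (ends '' (↑t : Set ι)) p ∪ openCluster (ends '' (↑t : Set ι)) q)) - f {x}) *
        (g (insert x (openCluster (ends '' (↑t : Set ι)) p ∪ openCluster (ends '' (↑t : Set ι)) q)) - g {x})) +
    (∑ t ∈ ((E.erase e₁).erase e₂).powerset.filter (fun t : Finset ι => ∀ w ∈ W,
          ¬ (w ∈ openCluster (ends '' (↑t : Set ι)) p ∧ w ∈ openCluster (ends '' (↑(((E.erase e₁).erase e₂) \ t) : Set ι)) q)),
      (f (insert x (openCluster (ends '' (↑t : Set ι)) p)) - f (insert x (openCluster (ends '' (↑(((E.erase e₁).erase e₂) \ t) : Set ι)) q))) *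
        (g (insert x (openCluster (ends '' (↑t : Set ι)) p)) - g (insert x (openCluster (ends '' (↑(((E.erase e₁).erase e₂) \ t) : Set ι)) q))))) :
    0 ≤ ∑ s ∈ E.powerset.filter (fun s : Finset ι =>
          ∀ w ∈ W, ¬ (w ∈ openCluster (ends '' (↑s : Set ι)) x ∧ w ∈ openCluster (ends '' (↑(E \ s) : Set ι)) x)),
      (f (openCluster (ends '' (↑s : Set ι)) x) - f (openCluster (ends '' (↑(E \ s) : Set ι)) x)) *
        (g (openCluster (ends '' (↑s : Set ι)) x) - g (openCluster (ends '' (↑(E \ s) : Set ι)) x)) := by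
  rw [ncStar_rootDegTwo_eq ends E he₁ he₂ hne h₁ h₂ hroot W hxW f g]
  linarith

end sums

end Coefficientwise

end Summit.CriticalPhenomena.PercolationContinuityZ3.Theorems
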